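import Summits.HodgeConjecture.HodgeConjecture.Theorems.R90S6UnitaryTwoRootStar          -- ★ this seat (REG2 FILE 1): the root star `Λ_t ∕ Λ_∞` — adjacency, exhaustion, faithfulness; brings ★ `natCard_antifixed_residueField_eq`, ★ `HermitianLatticeTree*`
import Summits.HodgeConjecture.HodgeConjecture.Theorems.R90S6TreeTypeSwapU2              -- ★ K2E3-p28 (g4): `exists_typeSwap_latticeTreeIso_of_datum` (the type-swapping automorphism of `X₂`)
import HarnessLib

/-!
# R90 · S6 — CARD «REG2», FILE 2: THE TREE `X₂` OF `U(1,1)_w` IS `(q+1)`-REGULAR — the binders `hloc`, `hreg` of every ★ H-side organ, from the residual letters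
# (`Theorems/R90S6UnitaryTwoTreeRegular.lean`)

Cell `hodgecm-mathlib`, crux H413 (`stmt-HodgeConjecture-24833`), route of record `HCCMUnconditional`; programme R90-TF, section S6 (base `R90-C14`), seat
R90-C14-p03 (g3); card «REG2» (dealer R90-C14-plan (g2), R90 bus 2026-09-05T03:11:42Z; consumers G1 (p02), G2, G5, FIN).  Helper lane `--supports
stmt-HodgeConjecture-24833 --as helper`; THEOREMS ONLY (no definition, no instance, no notation, no named fact, no `sorry`).

SETTING.  `K : Type` with `Valued K ℤᵐ⁰` and `ValuativeRel K` compatible, `hd : UnramifiedLocalConjDatum σ ϖ`, `J₂ = (StdForm.antidiagonal 2).over K`, `U₂ = unitaryGroupOfForm σ J₂`,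
`X₂ = latticeTree σ ϖ J₂`.  RESIDUAL LETTERS (VERBATIM the ★ (R3c) `UnitaryTwoIwahoriStarFixedPoints.natCard_unitaryTwo_star` shape, `ValuativeRel` currency):
`σO : 𝒪[K] →+* 𝒪[K]` the restriction of `σ` (`hσO'`), an integer `a₀` moved by a unit (`ha₀ : IsUnit (σO a₀ − a₀)`, the unramified letter), the reduction
`τ : 𝓀[K] →+* 𝓀[K]` of `σO` (`hτ`), `[Finite 𝓀[K]]`, `hq : Nat.card 𝓀[K] = q²`; no Frobenius letter is needed.  TRANSITIVITY of `U₂` on the self-dual vertices is the BINDER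
`hA` of ★ H2 ∕ ★ A1-H (discharged over a non-archimedean local FIELD by ★ `forall_isSelfDualLattice_exists_latt_eq_of_isUnit_sub`; a letter at the abstract `K`).

THE MATHEMATICS (Serre, *Trees*, II.1.1; Bruhat–Tits §10; Kottwitz 1988 §2).
* §1 **`finite_neighborSet_root_and_ncard_eq` — `#N(𝒪²) = #{t̄ ∈ 𝓀 : τt̄ = −t̄} + 1 = q + 1`** and the star is finite: FILE 1 identifies the star of the root with
  `{Λ_t : τ t̄ = −t̄} ⊔ {Λ_∞}` faithfully (the isotropic points of `ℙ(𝓀²)`), and ★ `natCard_antifixed_residueField_eq` counts `#{τ t̄ = −t̄} = q`.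
* §2 ALL VERTICES: a self-dual `v` is `u·𝒪²` (`hA`) and the automorphism `latticeTreeIso u` maps the star of the root onto the star of `v` (Mathlib `Iso.mapNeighborSet`);
  a `ϖ`-modular `v` is sent to a self-dual vertex by K2E3-p28's ★ type-swapping automorphism, with an equinumerous star.  **`finite_neighborSet_latticeTree_two`,
  `ncard_neighborSet_latticeTree_two_eq : #N(v) = q + 1`** — the letters `hloc`, `hreg` of ★ HF1 A3 :102–:103, ★ HF2 F2 :175–:176, ★ H2-NUMBERS :120–:127.
HONEST LABEL: lattice∕residue bookkeeping over ★ carriers; proves no printed global statement, discharges no citation; count-neutral helper.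
HC_CM is proved only modulo the 7 printed citations (2 remaining named inputs: hLiu418 = stmt-HodgeConjecture-24832, h413 = stmt-HodgeConjecture-24833) until rung 0 closes; REL ≠ ★ ≠ BUILT.

## References
* [Serre1980Trees] J.-P. Serre, *Trees* (1980): II.1.1 (the tree of a rank-one group over a local field; every vertex has `q + 1` neighbours).
* [BruhatTits1972] F. Bruhat, J. Tits, *Groupes réductifs sur un corps local I*, Publ. Math. IHÉS 41 (1972): §10 (rank one: the building is a tree; valencies).
* [Kottwitz1988] R. E. Kottwitz, *Tamagawa numbers*, Ann. of Math. 127 (1988): §2 (the tree of the unramified `U(1,1)`).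
* [Serre1979] J.-P. Serre, *Local Fields*, GTM 67 (1979): Ch. V §2 (unramified quadratic extensions: `#{t̄ : τt̄ = −t̄} = q`).
-/

set_option autoImplicit false
-- the mandated namespace repeats the single-problem summit's segment (`HodgeConjecture.HodgeConjecture`)
set_option linter.dupNamespace false

noncomputable section

open Set Function
open scoped ValuativeRel Matrix MatrixGroups
open SimpleGraph Matrix ValuativeRel
open Literature.NumberTheory.Automorphic
open Literature.NumberTheory.Automorphic.HermitianLatticeTree
open Literature.Combinatorics.SimpleGraph

namespace Summit.HodgeConjecture.HodgeConjecture.R90.S6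

section Two

variable {K : Type} [Field K] [Valued K (WithZero (Multiplicative ℤ))] [ValuativeRel K]
  [(Valued.v : Valuation K (WithZero (Multiplicative ℤ))).Compatible] {σ : K →+* K} {ϖ : K}

/-! ## §1 The star of the root has `q + 1` vertices -/

/-- **THE STAR OF THE ROOT IS FINITE AND HAS `q + 1` VERTICES**: `N(𝒪²) = {Λ_t : τ t̄ = −t̄} ⊔ {Λ_∞}` faithfully (FILE 1), and `#{t̄ ∈ 𝓀 : τ t̄ = −t̄} = q` (★
`natCard_antifixed_residueField_eq`, `|𝓀| = q²`, `σ` moving an integer by a unit). [cite: Serre1980Trees, II.1.1] [cite: Serre1979, Ch. V §2] [cite: Kottwitz1988, §2] -/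
theorem finite_neighborSet_root_and_ncard_eq (hd : HermitianLattice.UnramifiedLocalConjDatum σ ϖ) (σO : 𝒪[K] →+* 𝒪[K])
    (hσO' : ∀ x : 𝒪[K], ((σO x : 𝒪[K]) : K) = σ x) {a₀ : 𝒪[K]} (ha₀ : IsUnit (σO a₀ - a₀)) (τ : 𝓀[K] →+* 𝓀[K])
    (hτ : ∀ x : 𝒪[K], IsLocalRing.residue 𝒪[K] (σO x) = τ (IsLocalRing.residue 𝒪[K] x)) [Finite 𝓀[K]] {q : ℕ} (hq : Nat.card 𝓀[K] = q ^ 2)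
    (x₀ : {M : Submodule 𝒪[K] (Fin 2 → K) // IsSpecialLattice σ ϖ ((StdForm.antidiagonal 2).over K) M})
    (hx₀ : x₀.1 = latt (1 : Matrix (Fin 2) (Fin 2) K)) :
    ((latticeTree σ ϖ ((StdForm.antidiagonal 2).over K)).neighborSet x₀).Finite ∧
      ((latticeTree σ ϖ ((StdForm.antidiagonal 2).over K)).neighborSet x₀).ncard = q + 1 := by
  classical
  haveI := isDiscreteValuationRing_integer_of_compatible hd.vϖ
  have hσσ : ∀ x, σO (σO x) = x := fun x => Subtype.ext (by rw [hσO', hσO', hd.σσ])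
  have hcount : Nat.card {t : 𝓀[K] // τ t = -t} = q := natCard_antifixed_residueField_eq σO hσσ ha₀ τ hτ hq
  -- lifts of residues
  have hsurj : Function.Surjective (IsLocalRing.residue 𝒪[K]) := Ideal.Quotient.mk_surjective
  have hlift : ∀ a : 𝓀[K], IsLocalRing.residue 𝒪[K] (Function.surjInv hsurj a) = a := Function.surjInv_eq hsurj
  -- the explicit frames `L_t = !![1,0;t,1]` and `w = antidiag`
  have hLdet : ∀ t : 𝒪[K], (!![(1 : K), 0; (t : K), 1]).det ≠ 0 := fun t => by rw [Matrix.det_fin_two_of]; simp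
  have hLcoe : ∀ t : 𝒪[K], ((Matrix.GeneralLinearGroup.mkOfDetNeZero _ (hLdet t) : GL (Fin 2) K) : Matrix (Fin 2) (Fin 2) K) = !![(1 : K), 0; (t : K), 1] :=
    fun t => rfl
  have hLint : ∀ t : 𝒪[K], (Matrix.GeneralLinearGroup.mkOfDetNeZero _ (hLdet t) : GL (Fin 2) K) ∈ glInt 2 K := by
    intro t
    obtain ⟨L, hL, hLt⟩ := exists_glInt_coe_eq_lowerUnipotent_two t
    have h : L = Matrix.GeneralLinearGroup.mkOfDetNeZero _ (hLdet t) := Units.ext (by rw [hLt, hLcoe])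
    exact h ▸ hL
  let w : GL (Fin 2) K := Matrix.GeneralLinearGroup.mkOfDetNeZero !![(0 : K), 1; 1, 0] (by simp [Matrix.det_fin_two_of])
  have hw : (w : Matrix (Fin 2) (Fin 2) K) = !![(0 : K), 1; 1, 0] := rfl
  -- the parametrisation of the star
  have hanti : ∀ a : {t : 𝓀[K] // τ t = -t}, τ (IsLocalRing.residue 𝒪[K] (Function.surjInv hsurj a.1)) = -IsLocalRing.residue 𝒪[K] (Function.surjInv hsurj a.1) :=
    fun a => by rw [hlift]; exact a.2
  let f : {t : 𝓀[K] // τ t = -t} → {M : Submodule 𝒪[K] (Fin 2 → K) // IsSpecialLattice σ ϖ ((StdForm.antidiagonal 2).over K) M} := fun a =>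
    ⟨latt (((Matrix.GeneralLinearGroup.mkOfDetNeZero _ (hLdet (Function.surjInv hsurj a.1)) : GL (Fin 2) K) : Matrix (Fin 2) (Fin 2) K) *
        Matrix.diagonal ![ϖ ^ (0 : ℤ), ϖ ^ (1 : ℤ)]),
      (latticeTree_adj_root_latt_lowerUnipotent hd σO hσO' τ hτ x₀ hx₀ _ (hanti a) _ (hLint _) (hLcoe _)).choose⟩
  have hf : ∀ a, (f a).1 = latt (((Matrix.GeneralLinearGroup.mkOfDetNeZero _ (hLdet (Function.surjInv hsurj a.1)) : GL (Fin 2) K) : Matrix (Fin 2) (Fin 2) K) *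
      Matrix.diagonal ![ϖ ^ (0 : ℤ), ϖ ^ (1 : ℤ)]) := fun a => rfl
  have hfadj : ∀ a, (latticeTree σ ϖ ((StdForm.antidiagonal 2).over K)).Adj x₀ (f a) :=
    fun a => (latticeTree_adj_root_latt_lowerUnipotent hd σO hσO' τ hτ x₀ hx₀ _ (hanti a) _ (hLint _) (hLcoe _)).choose_spec
  let v₁ : {M : Submodule 𝒪[K] (Fin 2 → K) // IsSpecialLattice σ ϖ ((StdForm.antidiagonal 2).over K) M} :=
    ⟨latt ((w : Matrix (Fin 2) (Fin 2) K) * Matrix.diagonal ![ϖ ^ (0 : ℤ), ϖ ^ (1 : ℤ)]), (latticeTree_adj_root_latt_antidiag hd x₀ hx₀ w hw).choose⟩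
  have hv₁ : v₁.1 = latt ((w : Matrix (Fin 2) (Fin 2) K) * Matrix.diagonal ![ϖ ^ (0 : ℤ), ϖ ^ (1 : ℤ)]) := rfl
  have hv₁adj : (latticeTree σ ϖ ((StdForm.antidiagonal 2).over K)).Adj x₀ v₁ := (latticeTree_adj_root_latt_antidiag hd x₀ hx₀ w hw).choose_spec
  -- faithfulness
  have hfinj : Function.Injective f := by
    intro a b hab
    have h := congrArg Subtype.val hab
    rw [hf, hf] at h
    have hres := ((latt_lowerUnipotent_eq_iff hd _ _ _ (hLcoe _) _ (hLcoe _) w hw).1).1 h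
    rw [hlift, hlift] at hres
    exact Subtype.ext hres
  have hv₁not : v₁ ∉ Set.range f := by
    rintro ⟨a, ha⟩
    have h := congrArg Subtype.val ha
    rw [hf, hv₁] at h
    exact (latt_lowerUnipotent_eq_iff hd _ _ _ (hLcoe (Function.surjInv hsurj a.1)) _ (hLcoe (Function.surjInv hsurj a.1)) w hw).2 h
  -- the star is `insert v₁ (range f)`
  have hstar : (latticeTree σ ϖ ((StdForm.antidiagonal 2).over K)).neighborSet x₀ = insert v₁ (Set.range f) := by
    ext Λ
    rw [SimpleGraph.mem_neighborSet, Set.mem_insert_iff, Set.mem_range]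
    constructor
    · intro hΛ
      rcases exists_eq_latt_lowerUnipotent_or_antidiag_of_adj_root hd σO hσO' τ hτ x₀ hx₀ Λ hΛ with ⟨t, L, ht, -, hLt, hΛL⟩ | ⟨w', hw', hΛw⟩
      · right
        refine ⟨⟨IsLocalRing.residue 𝒪[K] t, ht⟩, Subtype.ext ?_⟩
        rw [hf, hΛL]
        exact ((latt_lowerUnipotent_eq_iff hd _ _ _ (hLcoe _) L hLt w hw).1).2 (hlift _)
      · left
        apply Subtype.ext
        rw [hΛw, hv₁, show w' = w from Units.ext (by rw [hw', hw])]
    · rintro (rfl | ⟨a, rfl⟩)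
      · exact hv₁adj
      · exact hfadj a
  have hfin : (Set.range f).Finite := Set.finite_range f
  refine ⟨by rw [hstar]; exact hfin.insert v₁, ?_⟩
  rw [hstar, Set.ncard_insert_of_notMem hv₁not hfin, ← Set.image_univ, Set.ncard_image_of_injective _ hfinj, Set.ncard_univ, hcount]

/-! ## §2 Every vertex has `q + 1` neighbours -/

/-- **SELF-DUAL VERTICES**: for `v = u·𝒪²` (`u ∈ U₂`, transitivity binder `hA`), `latticeTreeIso u` carries the star of the root onto the star of `v`: finite, of size `q + 1`.
[cite: Serre1980Trees, II.1.1] [cite: BruhatTits1972, §10] -/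
theorem finite_neighborSet_and_ncard_eq_of_isSelfDualLattice (hd : HermitianLattice.UnramifiedLocalConjDatum σ ϖ) (σO : 𝒪[K] →+* 𝒪[K])
    (hσO' : ∀ x : 𝒪[K], ((σO x : 𝒪[K]) : K) = σ x) {a₀ : 𝒪[K]} (ha₀ : IsUnit (σO a₀ - a₀)) (τ : 𝓀[K] →+* 𝓀[K])
    (hτ : ∀ x : 𝒪[K], IsLocalRing.residue 𝒪[K] (σO x) = τ (IsLocalRing.residue 𝒪[K] x)) [Finite 𝓀[K]] {q : ℕ} (hq : Nat.card 𝓀[K] = q ^ 2)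
    (hA : ∀ M : Submodule 𝒪[K] (Fin 2 → K), IsSelfDualLattice σ ((StdForm.antidiagonal 2).over K) M →
      ∃ u : unitaryGroupOfForm σ ((StdForm.antidiagonal 2).over K), latt (((u : GL (Fin 2) K)) : Matrix (Fin 2) (Fin 2) K) = M)
    (v : {M : Submodule 𝒪[K] (Fin 2 → K) // IsSpecialLattice σ ϖ ((StdForm.antidiagonal 2).over K) M})
    (hv : IsSelfDualLattice σ ((StdForm.antidiagonal 2).over K) v.1) :
    ((latticeTree σ ϖ ((StdForm.antidiagonal 2).over K)).neighborSet v).Finite ∧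
      ((latticeTree σ ϖ ((StdForm.antidiagonal 2).over K)).neighborSet v).ncard = q + 1 := by
  have hH := isUnimodular₂_antidiagonal_two (K := K)
  let x₀ : {M : Submodule 𝒪[K] (Fin 2 → K) // IsSpecialLattice σ ϖ ((StdForm.antidiagonal 2).over K) M} :=
    ⟨latt (1 : Matrix (Fin 2) (Fin 2) K), Or.inl (isSelfDualLattice_latt_one σ hH)⟩
  obtain ⟨hfin₀, hcard₀⟩ := finite_neighborSet_root_and_ncard_eq hd σO hσO' ha₀ τ hτ hq x₀ rfl
  obtain ⟨u, hu⟩ := hA v.1 hv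
  have hux : latticeTreeIso σ ϖ ((StdForm.antidiagonal 2).over K) u x₀ = v := by
    apply Subtype.ext
    change mapGL (u : GL (Fin 2) K) (latt (1 : Matrix (Fin 2) (Fin 2) K)) = v.1
    rw [show (1 : Matrix (Fin 2) (Fin 2) K) = ((1 : GL (Fin 2) K) : Matrix (Fin 2) (Fin 2) K) from Units.val_one.symm, mapGL_latt, mul_one, hu]
  have e := (latticeTreeIso σ ϖ ((StdForm.antidiagonal 2).over K) u).mapNeighborSet x₀
  rw [hux] at e
  haveI : Finite ↥((latticeTree σ ϖ ((StdForm.antidiagonal 2).over K)).neighborSet x₀) := hfin₀.to_subtype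
  refine ⟨Set.finite_coe_iff.1 (Finite.of_equiv _ e), ?_⟩
  rw [← Nat.card_coe_set_eq, ← Nat.card_congr e, Nat.card_coe_set_eq, hcard₀]

/-- **(R.1)+(R.2) THE TREE OF `U(1,1)_w` IS `(q+1)`-REGULAR AND LOCALLY FINITE, at BOTH vertex types**: for every vertex `v` of `X₂`, `N(v)` is finite with `#N(v) = q + 1`
(self-dual `v`: transitivity; `ϖ`-modular `v`: K2E3-p28's ★ type swap `exists_typeSwap_latticeTreeIso_of_datum` sends `v` to a self-dual vertex, carrying the star along).
[cite: Serre1980Trees, II.1.1] [cite: BruhatTits1972, §10] [cite: Kottwitz1988, §2] -/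
theorem finite_neighborSet_and_ncard_eq_latticeTree_two (hd : HermitianLattice.UnramifiedLocalConjDatum σ ϖ) (σO : 𝒪[K] →+* 𝒪[K])
    (hσO' : ∀ x : 𝒪[K], ((σO x : 𝒪[K]) : K) = σ x) {a₀ : 𝒪[K]} (ha₀ : IsUnit (σO a₀ - a₀)) (τ : 𝓀[K] →+* 𝓀[K])
    (hτ : ∀ x : 𝒪[K], IsLocalRing.residue 𝒪[K] (σO x) = τ (IsLocalRing.residue 𝒪[K] x)) [Finite 𝓀[K]] {q : ℕ} (hq : Nat.card 𝓀[K] = q ^ 2)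
    (hA : ∀ M : Submodule 𝒪[K] (Fin 2 → K), IsSelfDualLattice σ ((StdForm.antidiagonal 2).over K) M →
      ∃ u : unitaryGroupOfForm σ ((StdForm.antidiagonal 2).over K), latt (((u : GL (Fin 2) K)) : Matrix (Fin 2) (Fin 2) K) = M)
    (v : {M : Submodule 𝒪[K] (Fin 2 → K) // IsSpecialLattice σ ϖ ((StdForm.antidiagonal 2).over K) M}) :
    ((latticeTree σ ϖ ((StdForm.antidiagonal 2).over K)).neighborSet v).Finite ∧
      ((latticeTree σ ϖ ((StdForm.antidiagonal 2).over K)).neighborSet v).ncard = q + 1 := by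
  by_cases hv : IsSelfDualLattice σ ((StdForm.antidiagonal 2).over K) v.1
  · exact finite_neighborSet_and_ncard_eq_of_isSelfDualLattice hd σO hσO' ha₀ τ hτ hq hA v hv
  · have hmod : IsModularLattice σ ϖ ((StdForm.antidiagonal 2).over K) v.1 := v.2.resolve_left hv
    obtain ⟨T, h1, -, -, -, -⟩ := exists_typeSwap_latticeTreeIso_of_datum hd
    have hT : IsSelfDualLattice σ ((StdForm.antidiagonal 2).over K) (T v).1 := (h1 v).2 hmod
    obtain ⟨hfin₁, hcard₁⟩ := finite_neighborSet_and_ncard_eq_of_isSelfDualLattice hd σO hσO' ha₀ τ hτ hq hA (T v) hT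
    have e := T.mapNeighborSet v
    haveI : Finite ↥((latticeTree σ ϖ ((StdForm.antidiagonal 2).over K)).neighborSet (T v)) := hfin₁.to_subtype
    refine ⟨Set.finite_coe_iff.1 (Finite.of_equiv _ e.symm), ?_⟩
    rw [← Nat.card_coe_set_eq, Nat.card_congr e, Nat.card_coe_set_eq, hcard₁]

/-- **(R.1) `hloc`**: every star of `X₂` is finite — the binder `hloc : ∀ v, ((latticeTree σ ϖ J₂).neighborSet v).Finite` of ★ H2-NUMBERS ∕ ★ HF1 A3 ∕ ★ HF2 F2.
[cite: Serre1980Trees, II.1.1] [cite: BruhatTits1972, §10] -/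
theorem finite_neighborSet_latticeTree_two (hd : HermitianLattice.UnramifiedLocalConjDatum σ ϖ) (σO : 𝒪[K] →+* 𝒪[K])
    (hσO' : ∀ x : 𝒪[K], ((σO x : 𝒪[K]) : K) = σ x) {a₀ : 𝒪[K]} (ha₀ : IsUnit (σO a₀ - a₀)) (τ : 𝓀[K] →+* 𝓀[K])
    (hτ : ∀ x : 𝒪[K], IsLocalRing.residue 𝒪[K] (σO x) = τ (IsLocalRing.residue 𝒪[K] x)) [Finite 𝓀[K]] {q : ℕ} (hq : Nat.card 𝓀[K] = q ^ 2)
    (hA : ∀ M : Submodule 𝒪[K] (Fin 2 → K), IsSelfDualLattice σ ((StdForm.antidiagonal 2).over K) M →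
      ∃ u : unitaryGroupOfForm σ ((StdForm.antidiagonal 2).over K), latt (((u : GL (Fin 2) K)) : Matrix (Fin 2) (Fin 2) K) = M)
    (v : {M : Submodule 𝒪[K] (Fin 2 → K) // IsSpecialLattice σ ϖ ((StdForm.antidiagonal 2).over K) M}) :
    ((latticeTree σ ϖ ((StdForm.antidiagonal 2).over K)).neighborSet v).Finite :=
  (finite_neighborSet_and_ncard_eq_latticeTree_two hd σO hσO' ha₀ τ hτ hq hA v).1

/-- **(R.2) `hreg`**: every vertex of `X₂` has exactly `q + 1` neighbours (`|𝓀| = q²`) — the binder `hreg ∕ hdeg : ∀ v, ((latticeTree σ ϖ J₂).neighborSet v).ncard = q + 1`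
of ★ H2-NUMBERS :120–:127 ∕ ★ HF1 A3 :102–:103 ∕ ★ HF2 F2 :175–:176, at BOTH vertex types. [cite: Serre1980Trees, II.1.1] [cite: BruhatTits1972, §10] [cite: Kottwitz1988, §2] -/
theorem ncard_neighborSet_latticeTree_two_eq (hd : HermitianLattice.UnramifiedLocalConjDatum σ ϖ) (σO : 𝒪[K] →+* 𝒪[K])
    (hσO' : ∀ x : 𝒪[K], ((σO x : 𝒪[K]) : K) = σ x) {a₀ : 𝒪[K]} (ha₀ : IsUnit (σO a₀ - a₀)) (τ : 𝓀[K] →+* 𝓀[K])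
    (hτ : ∀ x : 𝒪[K], IsLocalRing.residue 𝒪[K] (σO x) = τ (IsLocalRing.residue 𝒪[K] x)) [Finite 𝓀[K]] {q : ℕ} (hq : Nat.card 𝓀[K] = q ^ 2)
    (hA : ∀ M : Submodule 𝒪[K] (Fin 2 → K), IsSelfDualLattice σ ((StdForm.antidiagonal 2).over K) M →
      ∃ u : unitaryGroupOfForm σ ((StdForm.antidiagonal 2).over K), latt (((u : GL (Fin 2) K)) : Matrix (Fin 2) (Fin 2) K) = M)
    (v : {M : Submodule 𝒪[K] (Fin 2 → K) // IsSpecialLattice σ ϖ ((StdForm.antidiagonal 2).over K) M}) :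
    ((latticeTree σ ϖ ((StdForm.antidiagonal 2).over K)).neighborSet v).ncard = q + 1 :=
  (finite_neighborSet_and_ncard_eq_latticeTree_two hd σO hσO' ha₀ τ hτ hq hA v).2

end Two

end Summit.HodgeConjecture.HodgeConjecture.R90.S6

end
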